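import Mathlib
import HarnessLib
import Summits.ValiantsHypothesis.ValiantsHypothesis.Theorems.MonotoneRestorationMonotoneRestorationQPLinearWidthAffineWitness

/-!
# Route MonotoneRestoration, crux `MonotoneRestorationQP` (stmt-15886), line `linear_width` —
# CFI STRICTNESS FOR ODD COVERS (ROBERSON'S ODDOMORPHISM CRITERION, SUFFICIENCY, IN THE TREE'S CFI MODEL)

Helper file (`--supports stmt-ValiantsHypothesis-15886`), def-free.  Companion of `…LinearWidthCFIHomMonotone`
(p841399) and `…LinearWidthAffineWitness` (p841762).

The tree's strictness theorem `CFIHomMonotone.card_hom_cfiGraph_lt_of_retract` needs the 2-subdivision `G₂` of the base as a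
RETRACT of the source graph `F`; through the affine witnesses this became the hypothesis (SUB₂) "every wide pattern contains
`subdiv B` as a subgraph", whose supply from the Excluded Grid Theorem needs an EXACT 2-subdivision of a wide base inside an
ARBITRARILY subdivided wall — the re-embedding lemma (RE) of census g14 (fix path lengths modulo `3` by detours; owed, `L`).

This file removes the exactness.  An **odd cover** of `G₂` by `F` is a homomorphism `ρ : F → G₂` with a pseudo-section
`s : V(G₂) → V(F)` (`ρ ∘ s = id`, NOT required to be a homomorphism) such that for every edge `y y'` of `G₂` the vertices
`s y`, `s y'` are joined by a chain of `F`-edges whose `ρ`-image ALTERNATES `y, y', y, …, y'` (odd length).  Retracts are odd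
covers (chains of length `1`); a subdivision of `G` in which every edge became a path of ODD length `≥ 3` is an odd cover
(fold each path onto `u, w_{uv}, w_{vu}, v` going back and forth) — no condition modulo `3`, only PARITY, with slack.

* `cfiGraph_adj_rect` — the bipartite graph between two fibres of `p : CFI(G,T) → G₂` is "rectangular"
  (`x ~ x' ~ x'' ~ x'''` with `p x = p x''`, `p x' = p x'''` forces `x ~ x'''`): gadget–link fibres see one link vertex per
  gadget vertex, link–link fibres are a perfect matching;
* `adj_of_alternating_chain` — hence a lift of an alternating chain joins its two ends;
* **`card_hom_cfiGraph_lt_of_oddCover`** — STRICTNESS: if `F` oddly covers `G₂` and `e` is an edge of `G`, then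
  `hom(F, CFI(G,{e})) < hom(F, CFI(G,∅))` (a lift of `ρ` into the twisted graph would give, through `s` and the chains, a
  section over the identity of `G₂`, excluded by Chen–Flum–Liu's parity count `not_isHom_of_proj_eq`); this is the
  sufficiency half of Roberson's criterion (weak oddomorphism ⇒ strict inequality) transposed to the tree's CFI graphs;
* `oddCover_of_retract` — retracts are odd covers (so p841399's strictness is the special case);
* `oddCover_subpattern_of_injective` — odd covers push forward along injective homomorphisms into pattern graphs (to the
  sub-pattern of the image edges, via `AffineWitness.exists_subpattern_retract`);
* `exists_fin_hosts_odd`, **`exists_homIndist_affineWitness_of_oddCover`** — the CFI pair on `Fin |CFI(G)|` is strict for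
  every odd cover, and the affine pair `𝟙_X + J, 𝟙_Y + J` separates `hom_E` for every bipartite pattern `E` into which an
  odd cover of `G₂` maps injectively (`G` connected, `≥ 2` vertices, `tw G ≥ k ≥ 1`), at level `ν = |CFI(G)|`;
* **`widthRung_sqrt_of_oddCovers`** — the capstone with (SUB₂) weakened to **(ODD₂)_{C,g}**: every isolated-free wide
  pattern receives injectively an odd cover `S` of `B₂` for a connected wide base `B` with `|CFI(B)| ≤ C(a+b+1)`; then
  `WidthRung (fun n => Nat.sqrt n / (3C+3))`.

Placement (honest label).  (ODD₂) follows from the Excluded Grid Theorem WITHOUT any re-embedding modulo `3`: a grid minor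
gives a `5`-subdivided wall as a topological minor (subcubic), i.e. a wall whose edges are paths of length `≥ 6` in the
pattern; subdividing once exactly the wall edges whose path has EVEN length gives a base `B` (still subcubic, connected, as
wide as the wall) of which the pattern contains an odd `≥ 3` subdivision.  Owed for that: the partial `1`-subdivision as an
object with its API [M], `subdiv_k(W_r) ≼ₘ grid_{(k+1)r}` [M], the odd-subdivision-to-odd-cover bridge on pattern graphs
[M], and the polynomial Excluded Grid Theorem by name [typer].  No stub closed; θ₁ (linear degree), the cruxes and VP ≠ VNP
NOT moved. [cite: Roberson2022, Thm 3.6 and Thm 3.13; ChenFlumLiu2025, Lemma 12.5, Thm 12.2, Thm 11.1; Dvorak2010, Thm 6]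
-/

set_option linter.dupNamespace false

noncomputable section

open scoped Classical

namespace Summit.ValiantsHypothesis.ValiantsHypothesis.Theorems.CFIOddCover

open MvPolynomial
open Literature.ModelTheory.FiniteModelTheory Literature.ModelTheory.FiniteModelTheory.ChenFlumLiu2025
open Literature.Computability.AlgebraicComplexity
open Summit.ValiantsHypothesis.ValiantsHypothesis.Theorems.MonotoneRestorationQPLinearWidth
open Summit.ValiantsHypothesis.ValiantsHypothesis.Theorems.CFIHomMonotone
open Summit.ValiantsHypothesis.ValiantsHypothesis.Theorems.AffineWitness

variable {v : ℕ} {G : SimpleGraph (Fin v)}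

/-! ### Fibres of the projection are rectangular -/

/-- **Rectangularity of the fibres.**  In `CFI(G,T)`, if `x ~ x'`, `x'' ~ x'` and `x'' ~ x'''` with `p x = p x''` and
`p x' = p x'''` (`p` the projection to `G₂`), then `x ~ x'''`: between the gadget fibre over `u` and the link fibre over
`w_{u,v}` every gadget vertex sees exactly one link vertex, and between the link fibres over `w_{u,v}`, `w_{v,u}` the edges
form a perfect matching. [cite: CaiFurerImmerman1992, §6; ChenFlumLiu2025, (12.4)] -/
theorem cfiGraph_adj_rect (T : Set (Sym2 (Fin v))) [DecidablePred (· ∈ T)] {x x' x'' x''' : CFIVertex G}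
    (hx : proj G x = proj G x'') (hx' : proj G x' = proj G x''')
    (h₁ : (cfiGraph G T).Adj x x') (h₂ : (cfiGraph G T).Adj x'' x') (h₃ : (cfiGraph G T).Adj x'' x''') :
    (cfiGraph G T).Adj x x''' := by
  rcases x with ⟨u, S⟩ | ⟨p, c⟩ <;> rcases x'' with ⟨u'', S''⟩ | ⟨p'', c''⟩ <;>
    simp only [proj, Sum.inl.injEq, Sum.inr.injEq, reduceCtorEq] at hx
  · -- gadget fibre to link fibre
    subst hx
    rcases x' with ⟨u', S'⟩ | ⟨p', c'⟩
    · exact absurd h₁ (cfiGraph_not_adj_inl_inl G T _ _)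
    rcases x''' with ⟨u''', S'''⟩ | ⟨p''', c'''⟩
    · exact absurd h₃ (cfiGraph_not_adj_inl_inl G T _ _)
    simp only [proj, Sum.inr.injEq] at hx'
    subst hx'
    rw [cfiGraph_adj_inl_inr] at h₁ h₂ h₃ ⊢
    refine ⟨h₁.1, ?_⟩
    rw [h₃.2, ← h₂.2]
    exact h₁.2
  · -- link fibre to gadget or link fibre
    subst hx
    rcases x' with ⟨u', S'⟩ | ⟨p', c'⟩ <;> rcases x''' with ⟨u''', S'''⟩ | ⟨p''', c'''⟩ <;>
      simp only [proj, Sum.inl.injEq, Sum.inr.injEq, reduceCtorEq] at hx'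
    · subst hx'
      rw [cfiGraph_adj_inr_inl] at h₁ h₂ h₃ ⊢
      refine ⟨h₃.1, ?_⟩
      have hcc : c = c'' := by
        rcases Bool.eq_false_or_eq_true c with hc | hc <;>
          rcases Bool.eq_false_or_eq_true c'' with hc'' | hc''
        · rw [hc, hc'']
        · exact absurd (h₁.2.1 hc) (fun hm => by simpa [hc''] using h₂.2.2 hm)
        · exact absurd (h₂.2.1 hc'') (fun hm => by simpa [hc] using h₁.2.2 hm)
        · rw [hc, hc'']
      rw [hcc]
      exact h₃.2
    · subst hx'
      rw [cfiGraph_adj_inr_inr] at h₁ h₂ h₃ ⊢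
      refine ⟨h₁.1, ?_⟩
      -- `c = c' ↔ τ`, `c'' = c' ↔ τ`, `c'' = c''' ↔ τ` give `c = c''' ↔ τ`
      have e₁ := h₁.2
      have e₂ := h₂.2
      have e₃ := h₃.2
      revert e₁ e₂ e₃
      cases c <;> cases c' <;> cases c'' <;> cases c''' <;> simp

/-- **Lifts of alternating chains join their ends.**  Let `f` be a homomorphism `F → CFI(G,T)` (as a bare function) and
`c 0 ~ c 1 ~ ⋯ ~ c (2n+1)` a chain of `F`-edges whose images under `p ∘ f` alternate between two vertices `y` (even
positions) and `y'` (odd positions).  Then `f (c 0) ~ f (c (2n+1))`. [cite: ChenFlumLiu2025, (12.4); Roberson2022, §3] -/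
theorem adj_of_alternating_chain (T : Set (Sym2 (Fin v))) [DecidablePred (· ∈ T)] {W : Type*} {F : SimpleGraph W}
    {f : W → CFIVertex G} (hf : Dvorak2010.IsHom F (cfiGraph G T) f) {y y' : Fin v ⊕ Dart G} (n : ℕ) (c : ℕ → W)
    (hadj : ∀ i, i ≤ 2 * n → F.Adj (c i) (c (i + 1)))
    (heven : ∀ i, i ≤ n → proj G (f (c (2 * i))) = y) (hodd : ∀ i, i ≤ n → proj G (f (c (2 * i + 1))) = y') :
    (cfiGraph G T).Adj (f (c 0)) (f (c (2 * n + 1))) := by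
  induction n with
  | zero => exact hf (hadj 0 le_rfl)
  | succ n ih =>
    have h₁ : (cfiGraph G T).Adj (f (c 0)) (f (c (2 * n + 1))) :=
      ih (fun i hi => hadj i (by omega)) (fun i hi => heven i (by omega)) (fun i hi => hodd i (by omega))
    have h₂ : (cfiGraph G T).Adj (f (c (2 * n + 2))) (f (c (2 * n + 1))) := by
      have := hf (hadj (2 * n + 1) (by omega))
      exact this.symm
    have h₃ : (cfiGraph G T).Adj (f (c (2 * n + 2))) (f (c (2 * n + 3))) := by
      have := hf (hadj (2 * n + 2) (by omega))
      simpa only [show 2 * n + 2 + 1 = 2 * n + 3 by ring] using this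
    have hx : proj G (f (c 0)) = proj G (f (c (2 * n + 2))) := by
      rw [show (0 : ℕ) = 2 * 0 by ring, heven 0 (Nat.zero_le _), show 2 * n + 2 = 2 * (n + 1) by ring,
        heven (n + 1) le_rfl]
    have hx' : proj G (f (c (2 * n + 1))) = proj G (f (c (2 * n + 3))) := by
      rw [hodd n (Nat.le_succ n), show 2 * n + 3 = 2 * (n + 1) + 1 by ring, hodd (n + 1) le_rfl]
    have := cfiGraph_adj_rect T hx hx' h₁ h₂ h₃
    simpa only [show 2 * (n + 1) + 1 = 2 * n + 3 by ring] using this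

/-! ### Strictness for odd covers -/

/-- **STRICTNESS FOR ODD COVERS (Roberson's oddomorphism criterion, sufficiency, tree's CFI model).**  Let `ρ : F → G₂` be a
homomorphism with a pseudo-section `s` (`ρ (s y) = y`) such that every edge `y ~ y'` of `G₂` is covered by an alternating
chain of `F`-edges from `s y` to `s y'` (`ρ`-images `y, y', …, y'`).  Then for every edge `e` of `G`,
`hom(F, CFI(G,{e})) < hom(F, CFI(G,∅))`: the fibrewise-difference injection (`exists_injective_projPreserving`) misses the
zero section over `ρ`, since a lift of `ρ` into the twisted graph would restrict along `s` — thanks to the chains — to a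
section over the identity of `G₂` (`not_isHom_of_proj_eq`). [cite: Roberson2022, Thm 3.13; ChenFlumLiu2025, Thm 12.2] -/
theorem card_hom_cfiGraph_lt_of_oddCover {W : Type*} [Finite W] (F : SimpleGraph W) {e : Sym2 (Fin v)}
    [DecidablePred (· ∈ ({e} : Set (Sym2 (Fin v))))] (he : e ∈ G.edgeSet)
    (ρ : F →g subdiv G) (s : Fin v ⊕ Dart G → W) (hs : ∀ y, ρ (s y) = y)
    (hchain : ∀ y y', (subdiv G).Adj y y' →
      ∃ (n : ℕ) (c : ℕ → W), c 0 = s y ∧ c (2 * n + 1) = s y' ∧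
        (∀ i, i ≤ 2 * n → F.Adj (c i) (c (i + 1))) ∧
        (∀ i, i ≤ n → ρ (c (2 * i)) = y) ∧ (∀ i, i ≤ n → ρ (c (2 * i + 1)) = y')) :
    Nat.card (F →g cfiGraph G ({e} : Set (Sym2 (Fin v)))) < Nat.card (F →g cfiEven G) := by
  classical
  rw [Dvorak2010.card_hom_eq_card_subtype, Dvorak2010.card_hom_eq_card_subtype]
  haveI := Fintype.ofFinite
    {g : W → CFIVertex G // Dvorak2010.IsHom F (cfiGraph G ({e} : Set (Sym2 (Fin v)))) g}
  haveI := Fintype.ofFinite {g : W → CFIVertex G // Dvorak2010.IsHom F (cfiEven G) g}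
  rw [Nat.card_eq_fintype_card, Nat.card_eq_fintype_card]
  obtain ⟨Φ, hΦ, hproj⟩ := exists_injective_projPreserving (G := G) F ({e} : Set (Sym2 (Fin v)))
  refine Fintype.card_lt_of_injective_not_surjective Φ hΦ fun hsurj => ?_
  -- the zero section over `ρ`
  have hzero : Dvorak2010.IsHom F (cfiEven G) (fun w => zeroLift (ρ w)) :=
    fun a b hab => isHom_zeroLift (ρ.map_rel hab)
  obtain ⟨f, hf⟩ := hsurj ⟨_, hzero⟩
  -- `f` lies over `ρ`
  have hpf : ∀ x, proj G (f.1 x) = ρ x := fun x => by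
    have h1 := hproj f x
    have h2 : (Φ f).1 x = zeroLift (ρ x) := congrFun (congrArg Subtype.val hf) x
    rw [h2, proj_zeroLift] at h1
    exact h1.symm
  -- restricting along `s` gives a section over the identity of `G₂`
  refine not_isHom_of_proj_eq he (f := fun y => f.1 (s y)) (fun y y' hyy' => ?_) fun y => by rw [hpf, hs]
  obtain ⟨n, c, hc0, hc1, hadj, hev, hod⟩ := hchain y y' hyy'
  have key := adj_of_alternating_chain ({e} : Set (Sym2 (Fin v))) (F := F) f.2 n c hadj
    (fun i hi => by rw [hpf, hev i hi]) (fun i hi => by rw [hpf, hod i hi])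
  rwa [hc0, hc1] at key

/-- **Retracts are odd covers**: if `ι : G₂ → F`, `ρ : F → G₂` with `ρ ∘ ι = id`, then `s = ι` with chains of length one.
Hence `CFIHomMonotone.card_hom_cfiGraph_lt_of_retract` is the special case of `card_hom_cfiGraph_lt_of_oddCover`. [folklore] -/
theorem oddCover_of_retract {W : Type*} (F : SimpleGraph W) (ι : subdiv G →g F) (ρ : F →g subdiv G)
    (hρι : ∀ x, ρ (ι x) = x) :
    (∀ y, ρ (ι y) = y) ∧
      ∀ y y', (subdiv G).Adj y y' →
        ∃ (n : ℕ) (c : ℕ → W), c 0 = ι y ∧ c (2 * n + 1) = ι y' ∧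
          (∀ i, i ≤ 2 * n → F.Adj (c i) (c (i + 1))) ∧
          (∀ i, i ≤ n → ρ (c (2 * i)) = y) ∧ (∀ i, i ≤ n → ρ (c (2 * i + 1)) = y') := by
  refine ⟨hρι, fun y y' hyy' => ⟨0, fun i => if i = 0 then ι y else ι y', by simp, by simp, ?_, ?_, ?_⟩⟩
  · intro i hi
    have hi0 : i = 0 := by omega
    subst hi0
    simpa using ι.map_rel hyy'
  · intro i hi
    have hi0 : i = 0 := by omega
    subst hi0
    simpa using hρι y
  · intro i hi
    have hi0 : i = 0 := by omega
    subst hi0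
    simpa using hρι y'

/-! ### Odd covers inside bipartite patterns -/

/-- **Odd covers push forward along injective homomorphisms into pattern graphs.**  If `S` oddly covers `G₂` and
`σ : S → patternGraph E` is injective, then the sub-pattern `E₀ ≤ E` of the image edges oddly covers `G₂`: compose `ρ` with
a retraction `patternGraph E₀ → S` (`AffineWitness.exists_subpattern_retract`), push `s` and the chains forward along the
corestriction of `σ`. [folklore] -/
theorem oddCover_subpattern_of_injective {a b : ℕ} (E : Multiset (Fin a × Fin b)) {W : Type*} [Nonempty W]
    {S : SimpleGraph W} (ρ : S →g subdiv G) (s : Fin v ⊕ Dart G → W) (hs : ∀ y, ρ (s y) = y)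
    (hchain : ∀ y y', (subdiv G).Adj y y' →
      ∃ (n : ℕ) (c : ℕ → W), c 0 = s y ∧ c (2 * n + 1) = s y' ∧
        (∀ i, i ≤ 2 * n → S.Adj (c i) (c (i + 1))) ∧
        (∀ i, i ≤ n → ρ (c (2 * i)) = y) ∧ (∀ i, i ≤ n → ρ (c (2 * i + 1)) = y'))
    (σ : S →g patternGraph E) (hσ : Function.Injective σ) :
    ∃ E₀ : Multiset (Fin a × Fin b), E₀ ≤ E ∧
      ∃ (ρ₀ : patternGraph E₀ →g subdiv G) (s₀ : Fin v ⊕ Dart G → Fin a ⊕ Fin b), (∀ y, ρ₀ (s₀ y) = y) ∧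
        ∀ y y', (subdiv G).Adj y y' →
          ∃ (n : ℕ) (c : ℕ → Fin a ⊕ Fin b), c 0 = s₀ y ∧ c (2 * n + 1) = s₀ y' ∧
            (∀ i, i ≤ 2 * n → (patternGraph E₀).Adj (c i) (c (i + 1))) ∧
            (∀ i, i ≤ n → ρ₀ (c (2 * i)) = y) ∧ (∀ i, i ≤ n → ρ₀ (c (2 * i + 1)) = y') := by
  obtain ⟨E₀, hE₀, ι, π, hπι⟩ := exists_subpattern_retract E σ hσ
  refine ⟨E₀, hE₀, ρ.comp π, fun y => ι (s y), fun y => ?_, fun y y' hyy' => ?_⟩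
  · show ρ (π (ι (s y))) = y
    rw [hπι, hs]
  · obtain ⟨n, c, hc0, hc1, hadj, hev, hod⟩ := hchain y y' hyy'
    refine ⟨n, fun i => ι (c i), by simp only [hc0], by simp only [hc1], fun i hi => ι.map_rel (hadj i hi),
      fun i hi => ?_, fun i hi => ?_⟩
    · show ρ (π (ι (c (2 * i)))) = y
      rw [hπι, hev i hi]
    · show ρ (π (ι (c (2 * i + 1)))) = y'
      rw [hπι, hod i hi]

/-- **The CFI hosts on `Fin |CFI(G)|`, strict for odd covers.**  For `G` connected on `≥ 2` vertices with `tw G ≥ k ≥ 1`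
and an edge: the transported pair `X ≅ CFI(G,∅)`, `Y ≅ CFI(G,{e})` is `C^k`-equivalent (Chen–Flum–Liu Thm 11.1, proved in
the tree), `hom(F, Y) ≤ hom(F, X)` for every finite `F`, and `<` for every `F` oddly covering `G₂`.
[cite: ChenFlumLiu2025, Thm 11.1, Thm 12.2; Roberson2022, Thm 3.6, Thm 3.13] -/
theorem exists_fin_hosts_odd {k : ℕ} (hconn : G.Connected) (h2 : 2 ≤ v) (hk : 1 ≤ k)
    (htw : k ≤ Literature.Combinatorics.SimpleGraph.treewidth G) (hE : G.edgeSet.Nonempty) :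
    ∃ (m : ℕ) (X Y : SimpleGraph (Fin m)), m = Fintype.card (CFIVertex G) ∧ CkEquiv k X Y ∧
      (∀ (W : Type) [Finite W] (F : SimpleGraph W), Nat.card (F →g Y) ≤ Nat.card (F →g X)) ∧
      (∀ (W : Type) [Finite W] (F : SimpleGraph W) (ρ : F →g subdiv G) (s : Fin v ⊕ Dart G → W),
        (∀ y, ρ (s y) = y) →
        (∀ y y', (subdiv G).Adj y y' →
          ∃ (n : ℕ) (c : ℕ → W), c 0 = s y ∧ c (2 * n + 1) = s y' ∧
            (∀ i, i ≤ 2 * n → F.Adj (c i) (c (i + 1))) ∧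
            (∀ i, i ≤ n → ρ (c (2 * i)) = y) ∧ (∀ i, i ≤ n → ρ (c (2 * i + 1)) = y')) →
        Nat.card (F →g Y) < Nat.card (F →g X)) := by
  obtain ⟨e, he⟩ := hE
  let φ := Fintype.equivFin (CFIVertex G)
  have hck := (ChenFlumLiu2025_ckEquiv_of_le_treewidth_holds v k G hconn h2 hk htw e he).iso_congr
    (SimpleGraph.Iso.map φ (cfiEven G)) (SimpleGraph.Iso.map φ (cfiGraph G ({e} : Set (Sym2 (Fin v)))))
  refine ⟨Fintype.card (CFIVertex G), _, _, rfl, hck, fun W _ F => ?_, fun W _ F ρ s hs hchain => ?_⟩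
  · rw [← card_hom_congr_right F (SimpleGraph.Iso.map φ (cfiEven G)),
      ← card_hom_congr_right F (SimpleGraph.Iso.map φ (cfiGraph G ({e} : Set (Sym2 (Fin v)))))]
    exact card_hom_cfiGraph_le F ({e} : Set (Sym2 (Fin v)))
  · rw [← card_hom_congr_right F (SimpleGraph.Iso.map φ (cfiEven G)),
      ← card_hom_congr_right F (SimpleGraph.Iso.map φ (cfiGraph G ({e} : Set (Sym2 (Fin v)))))]
    exact card_hom_cfiGraph_lt_of_oddCover F he ρ s hs hchain

/-- **THE AFFINE WITNESSES FOR ODD COVERS (unconditional).**  Let `G` be connected on `≥ 2` vertices with `tw G ≥ k ≥ 1` and an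
edge, let `S` oddly cover `G₂`, and let `S` map INJECTIVELY into the pattern graph of `E` (subgraph containment, induced or
not).  Then at level `ν = |CFI(G)|` the affine CFI pair `z = 𝟙_X + J`, `z' = 𝟙_Y + J` is `HomIndist ν k`-related and
`hom_E(z) ≠ hom_E(z')`: the difference is a sum over sub-patterns of nonnegative terms (Roberson monotonicity), strictly positive
at the sub-pattern of the image edges (odd-cover strictness). [cite: Roberson2022, Thm 3.6, Thm 3.13; ChenFlumLiu2025, Thm 11.1; Dvorak2010, Thm 6] -/
theorem exists_homIndist_affineWitness_of_oddCover {a b k : ℕ} (E : Multiset (Fin a × Fin b))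
    (hconn : G.Connected) (h2 : 2 ≤ v) (hk : 1 ≤ k)
    (htw : k ≤ Literature.Combinatorics.SimpleGraph.treewidth G) (hE : G.edgeSet.Nonempty)
    {W : Type*} [Nonempty W] {S : SimpleGraph W} (ρ : S →g subdiv G) (s : Fin v ⊕ Dart G → W) (hs : ∀ y, ρ (s y) = y)
    (hchain : ∀ y y', (subdiv G).Adj y y' →
      ∃ (n : ℕ) (c : ℕ → W), c 0 = s y ∧ c (2 * n + 1) = s y' ∧
        (∀ i, i ≤ 2 * n → S.Adj (c i) (c (i + 1))) ∧
        (∀ i, i ≤ n → ρ (c (2 * i)) = y) ∧ (∀ i, i ≤ n → ρ (c (2 * i + 1)) = y'))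
    (σ : S →g patternGraph E) (hσ : Function.Injective σ) :
    ∃ (ν : ℕ) (z z' : Fin ν × Fin ν → ℂ), ν = Fintype.card (CFIVertex G) ∧ HomIndist ν k z z' ∧
      eval z (homPoly E ν ℂ) ≠ eval z' (homPoly E ν ℂ) := by
  obtain ⟨E₀, hE₀, ρ₀, s₀, hs₀, hchain₀⟩ := oddCover_subpattern_of_injective E ρ s hs hchain σ hσ
  obtain ⟨m, X, Y, hm, hXY, hmono, hstrict⟩ := exists_fin_hosts_odd hconn h2 hk htw hE
  refine ⟨m, fun x => Set.indicator {ij : Fin m × Fin m | X.Adj ij.1 ij.2} (1 : Fin m × Fin m → ℂ) x + 1,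
    fun x => Set.indicator {ij : Fin m × Fin m | Y.Adj ij.1 ij.2} (1 : Fin m × Fin m → ℂ) x + 1, hm,
    HomIndistShift.homIndist_add_const (SimpleGraphCut.homIndist_indicator_of_ckEquiv hXY) 1, ?_⟩
  rw [eval_indicator_add_one_homPoly, eval_indicator_add_one_homPoly, Ne, Nat.cast_inj]
  apply ne_of_gt
  obtain ⟨U, hU⟩ := Multiset.le_iff_exists_add.1 hE₀
  have hp₀ : (E₀, U) ∈ Multiset.antidiagonal E := by
    rw [Multiset.mem_antidiagonal, hU]
  exact sum_map_lt_of_le_of_lt _ _ _ (fun p _ => hmono _ (patternGraph p.1)) hp₀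
    (hstrict _ (patternGraph E₀) ρ₀ s₀ hs₀ hchain₀)

/-- **Linear size, explicitly**: the level of the odd-cover witnesses is at most `v·2^Δ + 2vΔ` (`≤ 14v` for subcubic bases).
[cite: CaiFurerImmerman1992, §6] -/
theorem exists_homIndist_affineWitness_of_oddCover_le {a b k : ℕ} (E : Multiset (Fin a × Fin b))
    (hconn : G.Connected) (h2 : 2 ≤ v) (hk : 1 ≤ k)
    (htw : k ≤ Literature.Combinatorics.SimpleGraph.treewidth G) (hE : G.edgeSet.Nonempty)
    {W : Type*} [Nonempty W] {S : SimpleGraph W} (ρ : S →g subdiv G) (s : Fin v ⊕ Dart G → W) (hs : ∀ y, ρ (s y) = y)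
    (hchain : ∀ y y', (subdiv G).Adj y y' →
      ∃ (n : ℕ) (c : ℕ → W), c 0 = s y ∧ c (2 * n + 1) = s y' ∧
        (∀ i, i ≤ 2 * n → S.Adj (c i) (c (i + 1))) ∧
        (∀ i, i ≤ n → ρ (c (2 * i)) = y) ∧ (∀ i, i ≤ n → ρ (c (2 * i + 1)) = y'))
    (σ : S →g patternGraph E) (hσ : Function.Injective σ) :
    ∃ (ν : ℕ) (z z' : Fin ν × Fin ν → ℂ), ν ≤ v * 2 ^ G.maxDegree + 2 * (v * G.maxDegree) ∧ HomIndist ν k z z' ∧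
      eval z (homPoly E ν ℂ) ≠ eval z' (homPoly E ν ℂ) := by
  obtain ⟨ν, z, z', hν, hzz', hne⟩ :=
    exists_homIndist_affineWitness_of_oddCover E hconn h2 hk htw hE ρ s hs hchain σ hσ
  exact ⟨ν, z, z', hν ▸ card_cfiVertex_le, hzz', hne⟩

/-! ### The capstone with odd covers: (ODD₂) ⇒ the `√N` rung -/

/-- **(ODD₂) ⇒ (W1-lin) at every width `k ≥ 1`**: odd covers of 2-subdivided wide bases mapped injectively into every wide
pattern give linear-size `HomIndist` witnesses. [cite: Roberson2022, Thm 3.13; ChenFlumLiu2025, Thm 11.1] -/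
theorem linearWitness_of_oddCovers (C : ℕ) (g : ℕ → ℕ)
    (hODD : ∀ (k a b : ℕ) (E : Multiset (Fin a × Fin b)), 1 ≤ k →
      (∀ u : Fin a, ∃ x ∈ E, x.1 = u) → (∀ w : Fin b, ∃ x ∈ E, x.2 = w) →
      g k ≤ Literature.Combinatorics.SimpleGraph.treewidth (patternGraph E) →
      ∃ (v : ℕ) (B : SimpleGraph (Fin v)), B.Connected ∧ 2 ≤ v ∧
        k ≤ Literature.Combinatorics.SimpleGraph.treewidth B ∧ B.edgeSet.Nonempty ∧
        Fintype.card (CFIVertex B) ≤ C * (a + b + 1) ∧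
        ∃ (n : ℕ) (S : SimpleGraph (Fin (n + 1))) (ρ : S →g subdiv B) (s : Fin v ⊕ Dart B → Fin (n + 1)),
          (∀ y, ρ (s y) = y) ∧
          (∀ y y', (subdiv B).Adj y y' →
            ∃ (m : ℕ) (c : ℕ → Fin (n + 1)), c 0 = s y ∧ c (2 * m + 1) = s y' ∧
              (∀ i, i ≤ 2 * m → S.Adj (c i) (c (i + 1))) ∧
              (∀ i, i ≤ m → ρ (c (2 * i)) = y) ∧ (∀ i, i ≤ m → ρ (c (2 * i + 1)) = y')) ∧
          ∃ σ : S →g patternGraph E, Function.Injective σ)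
    {k : ℕ} (hk : 1 ≤ k) (a b : ℕ) (E : Multiset (Fin a × Fin b))
    (hrow : ∀ u : Fin a, ∃ x ∈ E, x.1 = u) (hcol : ∀ w : Fin b, ∃ x ∈ E, x.2 = w)
    (htw : g k ≤ Literature.Combinatorics.SimpleGraph.treewidth (patternGraph E)) :
    ∃ ν : ℕ, ν ≤ C * (a + b + 1) ∧ ∃ z z' : Fin ν × Fin ν → ℂ, HomIndist ν k z z' ∧
      eval z (homPoly E ν ℂ) ≠ eval z' (homPoly E ν ℂ) := by
  obtain ⟨v, B, hconn, h2, htwB, hE, hcard, n, S, ρ, s, hs, hchain, σ, hσ⟩ := hODD k a b E hk hrow hcol htw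
  obtain ⟨ν, z, z', hν, hzz', hne⟩ :=
    exists_homIndist_affineWitness_of_oddCover E hconn h2 hk htwB hE ρ s hs hchain σ hσ
  exact ⟨ν, hν ▸ hcard, z, z', hzz', hne⟩

/-- **THE CAPSTONE WITH ODD COVERS: (ODD₂)_{C,g} with `g` polynomially bounded ⇒ the `√N` rung**
`WidthRung (fun n => Nat.sqrt n / (3C+3))`: every matrix-symmetric `VP` family of degree `≤ √n/(3C+3)` that is
`PolylogHomDetermined` has square-symmetric circuits of quasi-polynomial orbit size.  Same assembly as
`AffineWitness.widthRung_sqrt_of_subdivisions` (Kronecker isolation at level `C(2 deg + 1)`), with odd covers in place of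
subgraph copies of `B₂`. [cite: DawarPagoSeppelt2025, Thm 7.3, Thm 7.9; DawarWilsenach2025, §3.3; Roberson2022, Thm 3.13] -/
theorem widthRung_sqrt_of_oddCovers (C : ℕ) (g : ℕ → ℕ) (e : ℕ) (hg : ∀ k, g k ≤ (k + 2) ^ e)
    (hODD : ∀ (k a b : ℕ) (E : Multiset (Fin a × Fin b)), 1 ≤ k →
      (∀ u : Fin a, ∃ x ∈ E, x.1 = u) → (∀ w : Fin b, ∃ x ∈ E, x.2 = w) →
      g k ≤ Literature.Combinatorics.SimpleGraph.treewidth (patternGraph E) →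
      ∃ (v : ℕ) (B : SimpleGraph (Fin v)), B.Connected ∧ 2 ≤ v ∧
        k ≤ Literature.Combinatorics.SimpleGraph.treewidth B ∧ B.edgeSet.Nonempty ∧
        Fintype.card (CFIVertex B) ≤ C * (a + b + 1) ∧
        ∃ (n : ℕ) (S : SimpleGraph (Fin (n + 1))) (ρ : S →g subdiv B) (s : Fin v ⊕ Dart B → Fin (n + 1)),
          (∀ y, ρ (s y) = y) ∧
          (∀ y y', (subdiv B).Adj y y' →
            ∃ (m : ℕ) (c : ℕ → Fin (n + 1)), c 0 = s y ∧ c (2 * m + 1) = s y' ∧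
              (∀ i, i ≤ 2 * m → S.Adj (c i) (c (i + 1))) ∧
              (∀ i, i ≤ m → ρ (c (2 * i)) = y) ∧ (∀ i, i ≤ m → ρ (c (2 * i + 1)) = y')) ∧
          ∃ σ : S →g patternGraph E, Function.Injective σ) :
    WidthRung fun n => Nat.sqrt n / (3 * C + 3) := by
  intro f hsym _hVP hdegle hdet
  obtain ⟨c₀, hc₀⟩ := hdet
  obtain ⟨c', hc'⟩ := SmallWitnessRung.exists_polylog_dominates c₀ e
  refine ⟨c' + 3, fun N =>
    IsolationAnyLevel.qpOrbit_of_matrixSymmetric_of_smallDistinguishable₂ f c₀ c' hsym hc₀ (fun n => ?_) N⟩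
  -- the degree budget: `deg · C(2 deg + 1) ≤ n` from `deg ≤ √n / (3C+3)`
  have hdeg : (f n).totalDegree * (C * (2 * (f n).totalDegree + 1)) ≤ n := by
    have h0 : (f n).totalDegree ≤ Nat.sqrt n / (3 * C + 3) := hdegle n
    set d := (f n).totalDegree with hd
    set s := Nat.sqrt n with hs
    have h1 : (3 * C + 3) * d ≤ s :=
      calc (3 * C + 3) * d ≤ (3 * C + 3) * (s / (3 * C + 3)) := Nat.mul_le_mul_left _ h0
        _ ≤ s := Nat.mul_div_le s (3 * C + 3)
    have h2 : s * s ≤ n := Nat.sqrt_le n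
    have h3 : d ≤ d * d := by
      rcases Nat.eq_zero_or_pos d with h | h
      · simp [h]
      · exact Nat.le_mul_of_pos_left d h
    have h4 : (3 * C + 3) * d * ((3 * C + 3) * d) ≤ s * s := Nat.mul_le_mul h1 h1
    nlinarith [h1, h2, h3, h4]
  have hk1 : 1 ≤ (Nat.log 2 n + c₀) ^ c₀ := by
    rcases Nat.eq_zero_or_pos c₀ with h | h
    · simp [h]
    · exact Nat.one_le_pow _ _ (by omega)
  refine ⟨C * (2 * (f n).totalDegree + 1), hdeg, fun a b E ha hb hrow hcol htw => ?_⟩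
  obtain ⟨ν, hν, hwit⟩ := linearWitness_of_oddCovers C g hODD hk1 a b E hrow hcol
    (le_trans ((hg _).trans (hc' (Nat.log 2 n))) htw)
  have hνle : ν ≤ C * (2 * (f n).totalDegree + 1) := hν.trans (Nat.mul_le_mul_left C (by omega))
  exact exists_homIndist_witness_mono E hrow hcol hνle hwit

end Summit.ValiantsHypothesis.ValiantsHypothesis.Theorems.CFIOddCover

end
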